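import Summits.BirchSwinnertonDyer.BirchSwinnertonDyer.Theorems.ThetaPartnerAtTwoSignedControlAtTwoMuRealUnipotentTwo
import Summits.BirchSwinnertonDyer.BirchSwinnertonDyer.Theorems.KolyvaginRoadThreePTUnipotentOfPGroup
import HarnessLib

/-!
# Milne *ADT* I Thm. 4.10(b) `Ker γ¹ ⊆ Im β¹` for every module of order `p²` killed by `p` on which `Γ_K` acts
# through a `p`-GROUP, `K ∋ μₚ` — real places included; at `p = 2`: every such module of order `4` over EVERY
# number field (e.g. `E[2]` for `E` with a `K`-rational `2`-torsion point)

Route `ThetaPartnerAtTwo`, crux K4 `SignedControlAtTwo` (stmt-BirchSwinnertonDyer-20309), line `eulerchar` v10, lead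
`bsd-wall-tp2-p3` g4 (`--supports stmt-BirchSwinnertonDyer-20309`, helper).  File 5 of the real-place packet.

No descent is needed when the image of `Γ_K` on `M` is already a `p`-group: bsd-stepL koly's
`exists_unipotentTwo_data` writes `M` as an extension of two TRIVIAL modules of order `p`, and file 4's
`middleExact_canonical_of_unipotentTwo_all_real` applies.  At `p = 2` the root-of-unity hypothesis is free
(`ζ = -1`), whence:

* `middleExact_canonical_of_card_eq_sq_of_pow` — any `p`, `K ∋ μₚ`, `#M = p²`, `p·M = 0`, every `σ ∈ Γ_K` acting
  with `p`-power order; real places allowed;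
* **`middleExact_canonical_of_card_eq_four_of_pow`** — `p = 2`, EVERY number field `K`: Milne I 4.10(b) for every
  `Γ_K`-module of order `4` killed by `2` on which every `σ` acts with `2`-power order, at every admissible `S`;
* `middleExact_canonical_torsionGaloisModule_two_of_pow` — the same for `M = E[2]`
  (`W.torsionGaloisModule 2`) of an elliptic curve `E/K` whose `2`-division field is a `2`-extension (every `σ` of
  `2`-power order on `E[2]`: e.g. a `K`-rational point of order `2`).  For K4's habitat (`E(ℚ)[2] = 0`, so
  `[ℚ(E[2]):ℚ] ∈ {3, 6}`) the remaining input is the prime-to-`2` DESCENT with real places (not in the tree).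

HONEST FRAMING. THEOREMS ONLY; assembly of koly's `exists_unipotentTwo_data` with file 4; no item closes; BSD is not
proved by any of this.

References: [MilneADT2006] I Thm. 4.10(b); [SerreLocalFields1979] IX §1 Thm. 1; [SilvermanAEC2009] III.6.4.
-/

noncomputable section

open CategoryTheory Function NumberField IsDedekindDomain
open scoped NumberField ContRepresentation

set_option linter.dupNamespace false
set_option autoImplicit false

namespace Summit.BirchSwinnertonDyer.BirchSwinnertonDyer.Theorems.SignedEC.MuReal

open Field
open Literature.NumberTheory.GaloisRepresentations Literature.NumberTheory.GaloisCohomology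
open Literature.NumberTheory.GaloisRepresentations.DiscreteGaloisModule (mu MuCarrier TateDual tateDual
  localTatePairingZMod homOfIntertwining unramifiedSubgroup)
open _root_.TopRep _root_.ContRepresentation _root_.ContinuousCohomology
open Summit.BirchSwinnertonDyer.BirchSwinnertonDyer.Theorems.KolyvaginRoadThreePT
open Literature.NumberTheory.EllipticCurves WeierstrassCurve

variable {K : Type} [Field K] [NumberField K]

/-- **Milne I Thm. 4.10(b) for a module of order `p²` killed by `p` with `p`-GROUP action over `K ∋ μₚ`, THE
invariant maps, every admissible `S`, real places allowed**: `exists_unipotentTwo_data` +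
`middleExact_canonical_of_unipotentTwo_all_real`. [cite: MilneADT2006, Ch. I, Thm. 4.10(b)]
[cite: SerreLocalFields1979, IX §1 Thm. 1] -/
theorem middleExact_canonical_of_card_eq_sq_of_pow {p : ℕ} [hp : Fact p.Prime]
    {M : Type} [AddCommGroup M] [TopologicalSpace M] [DiscreteTopology M] [Finite M]
    {ζ : K} (hζ : IsPrimitiveRoot ζ p) (ρ : DiscreteGaloisModule K M)
    (hpM : ∀ m : M, p • m = 0) (hcard : Nat.card M = p ^ 2)
    (hpow : ∀ σ : absoluteGaloisGroup K, ∃ k : ℕ, (ρ σ) ^ (p ^ k) = 1)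
    {S : Finset (Place K)} (hSinf : ∀ w : InfinitePlace K, (Sum.inl w : Place K) ∈ S)
    (hS : ∀ v : HeightOneSpectrum (𝓞 K), (Sum.inr v : Place K) ∉ S →
      ((p : ℕ) : 𝓞 K) ∉ v.asIdeal ∧ GaloisRep.IsUnramifiedAt v ρ)
    (t : Π v : Place K, galoisCohomology (ρ.toLocal v) 1)
    (horth : ∀ y : galoisCohomology (ρ.tateDual p) 1,
      (∀ v : HeightOneSpectrum (𝓞 K), (Sum.inr v : Place K) ∉ S →
        galoisCohomology.localization (ρ.tateDual p) (Sum.inr v) 1 y ∈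
          unramifiedSubgroup (GaloisRep.toLocal v (ρ.tateDual p)) 1) →
      ∑ v ∈ S, localTatePairingZMod ρ p v (LocalInvariants.canonical K p v) (t v)
        (galoisCohomology.localization (ρ.tateDual p) v 1 y) = 0) :
    ∃ x : galoisCohomology ρ 1,
      (∀ v : HeightOneSpectrum (𝓞 K), (Sum.inr v : Place K) ∉ S →
        galoisCohomology.localization ρ (Sum.inr v) 1 x ∈ unramifiedSubgroup (GaloisRep.toLocal v ρ) 1) ∧
      ∀ v ∈ S, galoisCohomology.localization ρ v 1 x = t v := by
  obtain ⟨A, B, _, _, _, _, _, _, _, _, ρA, ρB, f, g, hA, hB, hcA, hcB, hpA, hpB, hSES⟩ :=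
    exists_unipotentTwo_data (τ := ρ) hpM hcard hpow
  haveI := DiscreteGaloisModule.TateDual.finite K B p
  exact middleExact_canonical_of_unipotentTwo_all_real hζ ρA ρ ρB hA hB hcA hcB hpA hpM hpB hSES hSinf hS t horth

/-- **`p = 2`: Milne I Thm. 4.10(b) over EVERY number field for every `Γ_K`-module of order `4` killed by `2` on
which every `σ ∈ Γ_K` acts with `2`-power order**, THE invariant maps `LocalInvariants.canonical K 2`, every
admissible `S ⊇ {v ∣ ∞}` (off which `v ∤ 2` and `M` is unramified): the root of unity `-1` lies in every `K`.
[cite: MilneADT2006, Ch. I, Thm. 4.10(b)] -/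
theorem middleExact_canonical_of_card_eq_four_of_pow [Fact (Nat.Prime 2)]
    {M : Type} [AddCommGroup M] [TopologicalSpace M] [DiscreteTopology M] [Finite M]
    (ρ : DiscreteGaloisModule K M) (h2M : ∀ m : M, 2 • m = 0) (hcard : Nat.card M = 2 ^ 2)
    (hpow : ∀ σ : absoluteGaloisGroup K, ∃ k : ℕ, (ρ σ) ^ (2 ^ k) = 1)
    {S : Finset (Place K)} (hSinf : ∀ w : InfinitePlace K, (Sum.inl w : Place K) ∈ S)
    (hS : ∀ v : HeightOneSpectrum (𝓞 K), (Sum.inr v : Place K) ∉ S →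
      ((2 : ℕ) : 𝓞 K) ∉ v.asIdeal ∧ GaloisRep.IsUnramifiedAt v ρ)
    (t : Π v : Place K, galoisCohomology (ρ.toLocal v) 1)
    (horth : ∀ y : galoisCohomology (ρ.tateDual 2) 1,
      (∀ v : HeightOneSpectrum (𝓞 K), (Sum.inr v : Place K) ∉ S →
        galoisCohomology.localization (ρ.tateDual 2) (Sum.inr v) 1 y ∈
          unramifiedSubgroup (GaloisRep.toLocal v (ρ.tateDual 2)) 1) →
      ∑ v ∈ S, localTatePairingZMod ρ 2 v (LocalInvariants.canonical K 2 v) (t v)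
        (galoisCohomology.localization (ρ.tateDual 2) v 1 y) = 0) :
    ∃ x : galoisCohomology ρ 1,
      (∀ v : HeightOneSpectrum (𝓞 K), (Sum.inr v : Place K) ∉ S →
        galoisCohomology.localization ρ (Sum.inr v) 1 x ∈ unramifiedSubgroup (GaloisRep.toLocal v ρ) 1) ∧
      ∀ v ∈ S, galoisCohomology.localization ρ v 1 x = t v := by
  haveI : CharP K 0 := CharP.ofCharZero K
  have hζ : IsPrimitiveRoot (-1 : K) 2 := IsPrimitiveRoot.neg_one 0 (by decide)
  exact middleExact_canonical_of_card_eq_sq_of_pow hζ ρ h2M hcard hpow hSinf hS t horth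

/-- **`M = E[2]`: Milne I Thm. 4.10(b) for the `2`-torsion of an elliptic curve `E` over ANY number field `K` whose
`2`-division field is a `2`-extension** (every `σ ∈ Γ_K` of `2`-power order on `E[2]`, e.g. when `E` has a
`K`-rational point of order `2`), THE invariant maps at level `2`, every admissible `S` (`#E[2] = 4`,
`natCard_geomTorsion`; `2 · E[2] = 0`). [cite: MilneADT2006, Ch. I, Thm. 4.10(b)] [cite: SilvermanAEC2009, Cor. III.6.4(b)] -/
theorem middleExact_canonical_torsionGaloisModule_two_of_pow [Fact (Nat.Prime 2)] (W : WeierstrassCurve K)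
    [W.IsElliptic] [Finite (geomTorsion W ((2 : ℕ) : ℤ))]
    (hpow : ∀ σ : absoluteGaloisGroup K, ∃ k : ℕ, ((W.torsionGaloisModule ((2 : ℕ) : ℤ)) σ) ^ (2 ^ k) = 1)
    {S : Finset (Place K)} (hSinf : ∀ w : InfinitePlace K, (Sum.inl w : Place K) ∈ S)
    (hS : ∀ v : HeightOneSpectrum (𝓞 K), (Sum.inr v : Place K) ∉ S →
      ((2 : ℕ) : 𝓞 K) ∉ v.asIdeal ∧ GaloisRep.IsUnramifiedAt v (W.torsionGaloisModule ((2 : ℕ) : ℤ)))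
    (t : Π v : Place K, galoisCohomology ((W.torsionGaloisModule ((2 : ℕ) : ℤ)).toLocal v) 1)
    (horth : ∀ y : galoisCohomology ((W.torsionGaloisModule ((2 : ℕ) : ℤ)).tateDual 2) 1,
      (∀ v : HeightOneSpectrum (𝓞 K), (Sum.inr v : Place K) ∉ S →
        galoisCohomology.localization ((W.torsionGaloisModule ((2 : ℕ) : ℤ)).tateDual 2) (Sum.inr v) 1 y ∈
          unramifiedSubgroup (GaloisRep.toLocal v ((W.torsionGaloisModule ((2 : ℕ) : ℤ)).tateDual 2)) 1) →
      ∑ v ∈ S, localTatePairingZMod (W.torsionGaloisModule ((2 : ℕ) : ℤ)) 2 v (LocalInvariants.canonical K 2 v) (t v)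
        (galoisCohomology.localization ((W.torsionGaloisModule ((2 : ℕ) : ℤ)).tateDual 2) v 1 y) = 0) :
    ∃ x : galoisCohomology (W.torsionGaloisModule ((2 : ℕ) : ℤ)) 1,
      (∀ v : HeightOneSpectrum (𝓞 K), (Sum.inr v : Place K) ∉ S →
        galoisCohomology.localization (W.torsionGaloisModule ((2 : ℕ) : ℤ)) (Sum.inr v) 1 x ∈
          unramifiedSubgroup (GaloisRep.toLocal v (W.torsionGaloisModule ((2 : ℕ) : ℤ))) 1) ∧
      ∀ v ∈ S, galoisCohomology.localization (W.torsionGaloisModule ((2 : ℕ) : ℤ)) v 1 x = t v := by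
  refine middleExact_canonical_of_card_eq_four_of_pow (W.torsionGaloisModule ((2 : ℕ) : ℤ))
    (fun P => Subtype.ext (by
      have h := (mem_geomTorsion_iff W ((2 : ℕ) : ℤ) (P : geomPoints W)).mp P.2
      rw [natCast_zsmul] at h
      exact h)) ?_ hpow hSinf hS t horth
  haveI : NeZero ((2 : ℕ) : K) := ⟨by exact_mod_cast (two_ne_zero : (2 : K) ≠ 0)⟩
  exact Literature.NumberTheory.EllipticCurves.natCard_geomTorsion W 2

end Summit.BirchSwinnertonDyer.BirchSwinnertonDyer.Theorems.SignedEC.MuReal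

end
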